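import Summits.BirchSwinnertonDyer.BirchSwinnertonDyer.Theorems.PrintX11aLowerHalfOfChildren
import Literature.NumberTheory.EllipticCurves.Wuthrich2014.ThreeAdicImageSupersingularProofs
import HarnessLib

/-!
# Crux `X11aLowerHalf` (item stmt-BirchSwinnertonDyer-19064) from the SEVEN registered stubs of line «birth» r10 — the W-81′ children
# glue whose first child is crux U3's nine-fact stub text VERBATIM (lead bsd-line-x11a-p1 gen 3; `--supports stmt-BirchSwinnertonDyer-19064` helper)

HONEST FRAMING. Three composition theorems; no definition, no named fact, no `sorry`. CONDITIONAL: every hypothesis is DISPLAYED —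
twenty-six statement-only named published facts (never proved; one of them, Skinner–Urban 3.6.4 (ram) rational, print-gap-flagged at 3),
K2's OPEN item 19948, Greenberg's analytic `μ = 0` on the deep SURJECTIVE X11a pairs at `p ≥ 5` (OPEN — LNM 1716 Conj. 1.11 on that locus) and
the lower half on the très-ramifié off-Kodaira deep locus at `3` (THE OPEN CORE).  The gate records a `conditional-result`; nothing is closed;
BSD is proved for no curve and no class.  beyond-print theorem: no.

## What and why (a separate file because `PrintX11aLowerHalfOfChildren.lean` is at the 400-line cap)

Crux U3's line finemu3 r6 (`Cruxes/UpperNonSurjThree/Lines/finemu3.lean`, item 20613) has ONE registered stub `FineMu.stub_nineFactsOddGS` — nine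
print-exact facts (Stein–Wuthrich 6.1 ×2, Greenberg–Stevens at odd primes, Kato 12.4, modularity, Kato §17.13 V′∕VI′∕XI′ `_contra`, Mazur 4.1) —
consumed by the landed glue `Theorems.upperNonSurjThree_of_nineFacts_oddGS_glue` (p625569); crux U5's finemu5 r7 (item 20614) shares that stub
verbatim (`Theorems.upperNonSurjFive_of_nonSurjCornerTwinMuAn_of_nineFactsOddGS_glue₃`, p630615).  Those nine facts are nine of the twenty of
line birth r9's `stub_twentyFactsLower`.  Birth r10 therefore registers `stub_nineFactsOddGS` (U3's text verbatim) + `stub_elevenFactsLower`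
(the other eleven) in place of `stub_twentyFactsLower` (now a theorem in the skeleton), and this file is the matching glue:

  `x11aLowerHalf_of_children_r10 : (U3's nine) → (eleven) → (SU 3.6.4 (ram) fact) → (5 partner facts) →
     Theses.ErratumRoadFive.NonSurjCornerTwinMuAn → (stub_muAnSurjDeepFive) → (stub_lowerTresRamifieThree) → Theses.PrintX11a.X11aLowerHalf`

so that the planner's W-81′ booking can file ONE nine-fact statement item consumed BY NAME by the glues of all three cruxes U3, U5, L (twenty
distinct facts in twenty slots instead of twenty-nine).  Proof: reassemble r8's twenty-two-fact bundle (the twenty from U3's nine + L's eleven, Wuthrich 2014 Lemma 20 from the tree's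
`Wuthrich2014.lemma20_surjective_threeAdic_of_semistable_holds`, the (ram) fact) and apply `x11aLowerHalf_of_children_r8` (p632979) —
definitionally the r9 glue `x11aLowerHalf_of_children_r9` (p634475) after `printFactsLower_of_twentyFacts_of_suRamFact`.  Closing recipe once children C₁ … C₆ are filed with these exact statements (19948 exists):
`theorem X11aLowerHalf_holds : Theses.PrintX11a.X11aLowerHalf := x11aLowerHalf_of_children_r10 C_nine C_eleven C_ram C_facts5 C_19948 C_surj C_tres`
(`--workitem stmt-BirchSwinnertonDyer-19064`).

References: [SteinWuthrich2013] Thm. 6.1; [Kato2004Asterisque] Thm. 12.4, §17.13; [Mazur1978] Cor. 4.1; [EmertonPollackWeston2006] Thm. 1,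
Thm. 3.1.1, Thm. 5.1.3, Cor. 5.1.4; [Wan2015] Thm. 4; [SkinnerUrban2014] Thm. 3.6.4; [GreenbergLNM1716] Conj. 1.11; [Miller2011LMS] Def. 1.1;
cell files `Cruxes/X11aLowerHalf/Lines/birth.lean` (r10), `Cruxes/UpperNonSurjThree/Lines/finemu3.lean` (r6), `LEAD-g3-VERDICT.md`.
-/

set_option autoImplicit false
set_option linter.dupNamespace false -- the directory name repeats the summit name (sibling precedent)

noncomputable section

open scoped Classical

open WeierstrassCurve IsDedekindDomain Rat.HeightOneSpectrum
  Literature.NumberTheory.EllipticCurves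
  Literature.NumberTheory.EllipticCurves.ModularForms
  Literature.NumberTheory.EllipticCurves.Rank1Residual
  Literature.NumberTheory.EllipticCurves.Rank1Residual.Typed
  Literature.NumberTheory.EllipticCurves.Wuthrich2014
  Literature.NumberTheory.EllipticCurves.SteinWuthrich2013
  Literature.NumberTheory.EllipticCurves.Greenberg1999
  Literature.NumberTheory.EllipticCurves.Kato2004
  Literature.NumberTheory.EllipticCurves.GreenbergVatsal2000
  Literature.NumberTheory.EllipticCurves.EmertonPollackWeston2006
  Literature.NumberTheory.EllipticCurves.SkinnerUrban2014
  Literature.NumberTheory.EllipticCurves.BalakrishnanEtAl2019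
  Summit.BirchSwinnertonDyer.Rank1Residual

namespace Summit.BirchSwinnertonDyer.BirchSwinnertonDyer.Theorems.Birth

/-- **r9's twenty-fact bundle from the SHARED NINE (crux U3's registered stub text `FineMu.stub_nineFactsOddGS`, finemu3 r6 = the hypothesis
of `Theorems.upperNonSurjThree_of_nineFacts_oddGS_glue`, also finemu5 r7's) and L's ELEVEN other facts** (pure reassembly in r8's order).
[cite: SteinWuthrich2013, Thm. 6.1 (p. 20)] [cite: Kato2004Asterisque, Thm. 12.4 (p. 221), §17.13 (pp. 279–280)] [cite: EmertonPollackWeston2006, Thm. 1] -/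
theorem twentyFactsLower_of_nineFactsOddGS_of_elevenFacts
    (h9 : thm61_splitMultiplicative ∧ thm61_nonsplitMultiplicative ∧
      (∀ (W : WeierstrassCurve ℚ) [W.IsElliptic] [W.IsGloballyMinimal] (p : ℕ) [Fact p.Prime],
        p ≠ 2 → greenberg_stevens (W := W) (p := p)) ∧
      Kato2004.thm12_4 ∧ exists_isNewformOf ∧
      Kato2004.exists_multDivisibilityInputs_nonsplit_contra ∧
      Kato2004.exists_multDivisibilityInputs_split_contra ∧
      Kato2004.exists_multDivisibilityInputs_fine_contra ∧ mazur_not_dvd_maninConstant_of_odd)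
    (h11 : thm311_cotorsion_weightK_member_ofLevel_odd ∧ thm1_muAlg_of_weightK_member_ofLevel_odd ∧
      Wan2015.thm4_rational_weightK_member_of_bdd_ofLevel_irred ∧
      thm513_transfer_from_weightK_member_of_bdd_ofLevel_odd ∧
      DeligneSerre1974.thm61_exists_adicGaloisRep ∧ Hida2000_thm326_ordinary ∧
      kato_charIdeal_dvd_multiplicative_of_surjective ∧
      rank_eq_analyticRank_of_analyticRank_le_one ∧
      thm12_not_le_normalizer_splitCartan ∧
      ribet1990_levelLowering_gamma0_newform_at_three_additiveDrop ∧
      carayolLivne_additivePrime_dvd_level_of_congruent_newform) :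
    exists_isNewformOf ∧
      thm311_cotorsion_weightK_member_ofLevel_odd ∧ thm1_muAlg_of_weightK_member_ofLevel_odd ∧
      Wan2015.thm4_rational_weightK_member_of_bdd_ofLevel_irred ∧
      thm513_transfer_from_weightK_member_of_bdd_ofLevel_odd ∧
      DeligneSerre1974.thm61_exists_adicGaloisRep ∧ Hida2000_thm326_ordinary ∧
      kato_charIdeal_dvd_multiplicative_of_surjective ∧
      Kato2004.thm12_4 ∧
      Kato2004.exists_multDivisibilityInputs_nonsplit_contra ∧
      Kato2004.exists_multDivisibilityInputs_split_contra ∧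
      Kato2004.exists_multDivisibilityInputs_fine_contra ∧
      mazur_not_dvd_maninConstant_of_odd ∧
      thm61_splitMultiplicative ∧ thm61_nonsplitMultiplicative ∧
      rank_eq_analyticRank_of_analyticRank_le_one ∧
      (∀ (W : WeierstrassCurve ℚ) [W.IsElliptic] [W.IsGloballyMinimal] (p : ℕ) [Fact p.Prime],
        p ≠ 2 → greenberg_stevens (W := W) (p := p)) ∧
      thm12_not_le_normalizer_splitCartan ∧
      ribet1990_levelLowering_gamma0_newform_at_three_additiveDrop ∧
      carayolLivne_additivePrime_dvd_level_of_congruent_newform := by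
  obtain ⟨hJs, hJn, hGS, h12, hNf, hns', hsp', hfine', hMz⟩ := h9
  obtain ⟨h311, hT1a, hWan, hT1b, h61, h326, hKato, hGZK, hB, hRb, hCL⟩ := h11
  exact ⟨hNf, h311, hT1a, hWan, hT1b, h61, h326, hKato, h12, hns', hsp', hfine', hMz, hJs, hJn, hGZK, hGS, hB, hRb, hCL⟩

/-- **Crux L BY NAME from the SEVEN registered stubs of line «birth» r10, item 19948 BY NAME — the W-81′ children glue whose first child is
crux U3's nine-fact stub text VERBATIM** (`FineMu.stub_nineFactsOddGS` of finemu3 r6 ∕ finemu5 r7 = the hypothesis of the landed U3 glue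
`Theorems.upperNonSurjThree_of_nineFacts_oddGS_glue` and of the U5 glue `…upperNonSurjFive_of_nonSurjCornerTwinMuAn_of_nineFactsOddGS_glue₃`),
so that ONE nine-fact input item serves U3 (20613), U5 (20614) and L (19064).  CONDITIONAL (the gate records a `conditional-result`; closes
nothing; BSD is proved for no curve and no class).  Hypotheses, each VERBATIM a registered stub statement of `Cruxes/X11aLowerHalf/Lines/birth.lean`
r10: `h9` = `stub_nineFactsOddGS` (nine print-exact facts, = U3's), `h11` = `stub_elevenFactsLower` (L's eleven other print-exact facts),
`hR` = `stub_suRamFactLower` (Skinner–Urban 3.6.4 (ram) rational; flag SU14-12.3.6@3), `hQ` = `stub_partnerFactsLower` (five), `h48` =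
`stub_twinMuAn` = K2's item 19948, `hS` = `stub_muAnSurjDeepFive` (OPEN), `hT` = `stub_lowerTresRamifieThree` (OPEN CORE).  Closing recipe:
`theorem X11aLowerHalf_holds : Theses.PrintX11a.X11aLowerHalf := x11aLowerHalf_of_children_r10 C_nine C_eleven C_ram C_facts5 C_19948 C_surj C_tres`.
[cite: SteinWuthrich2013, Thm. 6.1 (p. 20)] [cite: Kato2004Asterisque, Thm. 12.4 (p. 221)] [cite: Wuthrich2014, Lemma 20 (p. 399)]
[cite: SkinnerUrban2014, Thm. 3.6.4 (p. 43)] [cite: GreenbergLNM1716, §1 Conj. 1.11 (p. 61)] [cite: Miller2011LMS, Def. 1.1 (arXiv:1010.2431 p. 3)] -/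
theorem x11aLowerHalf_of_children_r10
    (h9 : thm61_splitMultiplicative ∧ thm61_nonsplitMultiplicative ∧
      (∀ (W : WeierstrassCurve ℚ) [W.IsElliptic] [W.IsGloballyMinimal] (p : ℕ) [Fact p.Prime],
        p ≠ 2 → greenberg_stevens (W := W) (p := p)) ∧
      Kato2004.thm12_4 ∧ exists_isNewformOf ∧
      Kato2004.exists_multDivisibilityInputs_nonsplit_contra ∧
      Kato2004.exists_multDivisibilityInputs_split_contra ∧
      Kato2004.exists_multDivisibilityInputs_fine_contra ∧ mazur_not_dvd_maninConstant_of_odd)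
    (h11 : thm311_cotorsion_weightK_member_ofLevel_odd ∧ thm1_muAlg_of_weightK_member_ofLevel_odd ∧
      Wan2015.thm4_rational_weightK_member_of_bdd_ofLevel_irred ∧
      thm513_transfer_from_weightK_member_of_bdd_ofLevel_odd ∧
      DeligneSerre1974.thm61_exists_adicGaloisRep ∧ Hida2000_thm326_ordinary ∧
      kato_charIdeal_dvd_multiplicative_of_surjective ∧
      rank_eq_analyticRank_of_analyticRank_le_one ∧
      thm12_not_le_normalizer_splitCartan ∧
      ribet1990_levelLowering_gamma0_newform_at_three_additiveDrop ∧
      carayolLivne_additivePrime_dvd_level_of_congruent_newform)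
    (hR : thm364_rational_weightK_member_of_bdd_ofLevel_ram)
    (hQ : cor514_transfer_of_goodOrdinary_odd ∧ YanZhu2026.thm49_charIdeal_eq_padicLFunction ∧
      realPeriodRat_eq_unit_mul_plusPeriod_three ∧ thm1_muAlg_transfer_goodOrdinary_of_mult_odd ∧
      thm1_muAn_transfer_goodOrdinary_of_mult_odd)
    (h48 : Summit.BirchSwinnertonDyer.BirchSwinnertonDyer.Theses.ErratumRoadFive.NonSurjCornerTwinMuAn)
    (hS : ∀ (W : WeierstrassCurve ℚ) [W.IsElliptic] [W.IsGloballyMinimal] (p : ℕ) [Fact p.Prime],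
      ClassX11a W p → 5 ≤ p → Surj W p → ¬ X11a.ShaAnUnit W p → X11a.MuAnZeroAt W p)
    (hT : ∀ (W : WeierstrassCurve ℚ) [W.IsElliptic] [W.IsGloballyMinimal] (p : ℕ) [Fact p.Prime],
      ClassX11a W p → p = 3 → ¬ X11a.ShaAnUnit W p →
      ¬ (Surj W p ∧ ∃ v : HeightOneSpectrum ℤ, W.HasAdditiveReductionAt v ∧
          3 ∣ (W.kodairaSymbolAt v).componentGroupOrder ∧ ¬ natGenerator v ^ 3 ∣ W.conductorNorm ℤ) →
      ¬ p ∣ padicValInt p W.minimalDiscriminantInt → MissingLowerBoundAt W p) :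
    Summit.BirchSwinnertonDyer.BirchSwinnertonDyer.Theses.PrintX11a.X11aLowerHalf := by
  -- r8's twenty-two-fact bundle = the twenty (from U3's nine + L's eleven) + Wuthrich Lemma 20 FROM THE TREE + the (ram) fact,
  -- then the five-children glue of r8 (p632979); definitionally the same as `x11aLowerHalf_of_children_r9 (printFactsLower_of_… ) …`.
  obtain ⟨hNf, h311, hT1a, hWan, hT1b, h61, h326, hKato, h12, hns', hsp', hfine', hMz, hJs, hJn, hGZK, hGS, hB, hRb, hCL⟩ :=
    twentyFactsLower_of_nineFactsOddGS_of_elevenFacts h9 h11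
  exact x11aLowerHalf_of_children_r8 ⟨hNf, h311, hT1a, hWan, hT1b, h61, h326, hKato,
    Wuthrich2014.lemma20_surjective_threeAdic_of_semistable_holds, h12, hns', hsp', hfine', hMz, hJs, hJn, hGZK, hGS, hB, hRb, hR, hCL⟩
    hQ h48 hS hT

/-- The `ErratumRoadFive` spelling of the seven-children glue r10 (one statement under two route names, `Iff.rfl`).
[cite: Miller2011LMS, Def. 1.1 (arXiv:1010.2431 p. 3)] [cite: SteinWuthrich2013, Thm. 6.1 (p. 20)] -/
theorem x11aLowerHalf_erratumRoadFive_of_children_r10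
    (h9 : thm61_splitMultiplicative ∧ thm61_nonsplitMultiplicative ∧
      (∀ (W : WeierstrassCurve ℚ) [W.IsElliptic] [W.IsGloballyMinimal] (p : ℕ) [Fact p.Prime],
        p ≠ 2 → greenberg_stevens (W := W) (p := p)) ∧
      Kato2004.thm12_4 ∧ exists_isNewformOf ∧
      Kato2004.exists_multDivisibilityInputs_nonsplit_contra ∧
      Kato2004.exists_multDivisibilityInputs_split_contra ∧
      Kato2004.exists_multDivisibilityInputs_fine_contra ∧ mazur_not_dvd_maninConstant_of_odd)
    (h11 : thm311_cotorsion_weightK_member_ofLevel_odd ∧ thm1_muAlg_of_weightK_member_ofLevel_odd ∧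
      Wan2015.thm4_rational_weightK_member_of_bdd_ofLevel_irred ∧
      thm513_transfer_from_weightK_member_of_bdd_ofLevel_odd ∧
      DeligneSerre1974.thm61_exists_adicGaloisRep ∧ Hida2000_thm326_ordinary ∧
      kato_charIdeal_dvd_multiplicative_of_surjective ∧
      rank_eq_analyticRank_of_analyticRank_le_one ∧
      thm12_not_le_normalizer_splitCartan ∧
      ribet1990_levelLowering_gamma0_newform_at_three_additiveDrop ∧
      carayolLivne_additivePrime_dvd_level_of_congruent_newform)
    (hR : thm364_rational_weightK_member_of_bdd_ofLevel_ram)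
    (hQ : cor514_transfer_of_goodOrdinary_odd ∧ YanZhu2026.thm49_charIdeal_eq_padicLFunction ∧
      realPeriodRat_eq_unit_mul_plusPeriod_three ∧ thm1_muAlg_transfer_goodOrdinary_of_mult_odd ∧
      thm1_muAn_transfer_goodOrdinary_of_mult_odd)
    (h48 : Summit.BirchSwinnertonDyer.BirchSwinnertonDyer.Theses.ErratumRoadFive.NonSurjCornerTwinMuAn)
    (hS : ∀ (W : WeierstrassCurve ℚ) [W.IsElliptic] [W.IsGloballyMinimal] (p : ℕ) [Fact p.Prime],
      ClassX11a W p → 5 ≤ p → Surj W p → ¬ X11a.ShaAnUnit W p → X11a.MuAnZeroAt W p)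
    (hT : ∀ (W : WeierstrassCurve ℚ) [W.IsElliptic] [W.IsGloballyMinimal] (p : ℕ) [Fact p.Prime],
      ClassX11a W p → p = 3 → ¬ X11a.ShaAnUnit W p →
      ¬ (Surj W p ∧ ∃ v : HeightOneSpectrum ℤ, W.HasAdditiveReductionAt v ∧
          3 ∣ (W.kodairaSymbolAt v).componentGroupOrder ∧ ¬ natGenerator v ^ 3 ∣ W.conductorNorm ℤ) →
      ¬ p ∣ padicValInt p W.minimalDiscriminantInt → MissingLowerBoundAt W p) :
    Summit.BirchSwinnertonDyer.BirchSwinnertonDyer.Theses.ErratumRoadFive.X11aLowerHalf :=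
  x11aLowerHalf_of_children_r10 h9 h11 hR hQ h48 hS hT

end Summit.BirchSwinnertonDyer.BirchSwinnertonDyer.Theorems.Birth

end
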